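import Mathlib.Algebra.Group.Pi.Units
import Mathlib.Analysis.SpecificLimits.Basic
import Mathlib.RingTheory.Teichmuller
import Mathlib.RingTheory.Valuation.ExtendToLocalization
import Mathlib.RingTheory.Valuation.RankOne
import Mathlib.Topology.Algebra.Valued.NormedValued
import Summits.ABC.IUTFork.Joshi.ArithHolStructureTilt
import HarnessLib

/-!
# The tilt monoid datum of an untilt ON ITS OWN TILT — MODEL / SUPPLY for `TiltMonoidDatum` (merge-debt M-t10-1)

Block E (rung LADDER-ABC:A2.E), seat abc-iut-E-t10; companion of `ArithHolStructure.lean` (p431050→p437040) / `ArithHolStructureTilt.lean`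
(p433682→p437482), which type [J-I] = Joshi, arXiv:2106.11452v4 (render book:anonnd-2106-11452v4): the tilt `K♭` (§3.3 p.9 l.31–33, typed as
Mathlib's `Tilt` = `ATS1.tilt U`) and the untilt datum «with an isometry K♭ ≃ F» (§3.5 p.9 l.38–40; Def. 4.1.1 (1) p.18 l.11ff), the latter
POSITED as the hypothesis structure `ATS1.TiltMonoidDatum U F` (multiplicative `F → lim_{x ↦ x^p} K` onto the compatible sequences, isometric in
degree `0`). p431050's header recorded merge-debt **M-t10-1** (link it to Mathlib's Teichmüller/untilt map). THIS FILE PAYS IT — for every untilt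
`K` (E-t1's `Untilt p`) we CONSTRUCT, from Mathlib's `PreTilt` / `Perfection.quotientMulEquiv` / `PreTilt.val`:
* `isAdicComplete_int`: `𝒪_K` is `p`-adically complete (PROVED from completeness of `K`; the input of the Teichmüller map);
* `flatFr : K♭ →* (ℕ → K)`, `x ↦ (x^{♯ 1/pⁿ})_n` (`(𝒪_K/p)^perf ≃* lim 𝒪_K`, extended to `K♭ = Frac` by the monoid-localization lift), ONTO
  `lim_{x ↦ x^p} K` (`flatFr_surj`); `valFr` = `|·|_♭` on `K♭` with `|x|_♭ = |x^♯|_K` (`valInt_eq_nnnorm`, `nnnorm_flatFr_zero`); `normedFieldFr` /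
  `normedFieldTilt` = the normed field `(K♭, |·|_♭)` as an explicit `def` (NOT an instance);
* `tiltMonoidDatum U : TiltMonoidDatum U (tilt U)` — the datum ON THE TILT ITSELF, hypothesis-free; `TiltMonoidDatum.transport` /
  `tiltMonoidDatumOfIsometry`: any `F` multiplicatively isometric to `K♭` (Def. 4.1.1 (1) verbatim) inherits it;
* `range_norm_tilt_eq`: [J-I] Prop. 4.1.7 (1) p.19 l.29–30 «the same value groups as that of F» for `K` and `F = K♭` — UNCONDITIONAL; so the
  signature of p433682's `sameValueGroup_of_tiltMonoidDatum` is INHABITED at the genuine tilt (non-vacuity).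
All [folklore]: [Scholze 2012] = arXiv:1111.4914 «Perfectoid spaces», Lem. 3.4 (i)–(iii) p.12 (the reference of [J-I] §3.3); no claim of Joshi's
used or asserted; no `Prop` hypothesis, instance or notation introduced. A model exhibits satisfiability, nothing more; no side taken on
[IUTchIII] Cor. 3.12 or on any author. bears_on: LADDER-ABC:A2.E.
-/

noncomputable section

open scoped NNReal
open Filter Topology

namespace Summit.ABC.IUTFork.Joshi.ATS1

open Summit.ABC.IUTFork.Joshi

variable {p : ℕ} [Fact p.Prime]

namespace TiltModel

/-! ## 1. `𝒪_K` is `p`-adically complete ([folklore]; input of Mathlib's Teichmüller map) -/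

/-- `p ≠ 0` in an untilt (characteristic `0`). [folklore] -/
theorem natCast_p_ne_zero (U : Untilt p) : (p : U.K) ≠ 0 := Nat.cast_ne_zero.2 (Fact.out : p.Prime).ne_zero

/-- `x ∈ 𝒪_K ⟺ ‖x‖ ≤ 1`. [folklore] -/
theorem mem_int_iff (U : Untilt p) {x : U.K} : x ∈ int U ↔ ‖x‖ ≤ 1 := by
  rw [Valuation.mem_integer_iff, NormedField.valuation_apply, ← NNReal.coe_le_coe, coe_nnnorm, NNReal.coe_one]

/-- Elements of `𝒪_K` have norm `≤ 1`. [folklore] -/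
theorem norm_coe_le_one {U : Untilt p} (x : int U) : ‖(x : U.K)‖ ≤ 1 := (mem_int_iff U).1 x.2

/-- `x ∈ (p)^n = (p^n) ⟺ ‖x‖ ≤ ‖p‖^n` in `𝒪_K`. [folklore] -/
theorem mem_span_pow_iff (U : Untilt p) {x : int U} {n : ℕ} :
    x ∈ Ideal.span {((p : ℕ) : int U)} ^ n ↔ ‖(x : U.K)‖ ≤ ‖(p : U.K)‖ ^ n := by
  rw [Ideal.span_singleton_pow, Ideal.mem_span_singleton]
  constructor
  · rintro ⟨c, hc⟩
    have h := congrArg ((↑) : int U → U.K) hc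
    push_cast at h
    rw [h, norm_mul, norm_pow]
    exact mul_le_of_le_one_right (pow_nonneg (norm_nonneg _) _) (norm_coe_le_one c)
  · intro h
    have hpn : (p : U.K) ^ n ≠ 0 := pow_ne_zero _ (natCast_p_ne_zero U)
    have hc : ‖(x : U.K) / (p : U.K) ^ n‖ ≤ 1 := by
      rw [norm_div, norm_pow, div_le_one (pow_pos (norm_pos_iff.2 (natCast_p_ne_zero U)) _)]; exact h
    refine ⟨⟨(x : U.K) / (p : U.K) ^ n, (mem_int_iff U).2 hc⟩, Subtype.ext ?_⟩
    push_cast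
    rw [mul_comm, div_mul_cancel₀ _ hpn]

/-- **`𝒪_K` is `p`-adically complete** (Hausdorff: `‖p‖^n → 0`; precomplete: a `p`-adic Cauchy sequence is norm-Cauchy, converges in the
complete field `K`, and the limit lies in the closed unit ball with the expected congruences). PROVED. [folklore] -/
theorem isAdicComplete_int (U : Untilt p) : IsAdicComplete (Ideal.span {((p : ℕ) : int U)}) (int U) := by
  have hp1 : ‖(p : U.K)‖ < 1 := U.norm_p_lt_one
  refine (isAdicComplete_iff _ _).2 ⟨⟨fun x hx => ?_⟩, ⟨fun f hf => ?_⟩⟩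
  · have hx' : ∀ n, ‖(x : U.K)‖ ≤ ‖(p : U.K)‖ ^ n := fun n =>
      (mem_span_pow_iff U).1 (by simpa only [smul_eq_mul, Ideal.mul_top, SModEq.zero] using hx n)
    by_contra h0
    have hx0 : 0 < ‖(x : U.K)‖ := norm_pos_iff.2 fun h => h0 (Subtype.ext h)
    obtain ⟨n, hn⟩ := exists_pow_lt_of_lt_one hx0 hp1
    exact (not_lt.2 (hx' n)) hn
  · simp only [smul_eq_mul, Ideal.mul_top, SModEq.sub_mem, mem_span_pow_iff, AddSubgroupClass.coe_sub] at hf ⊢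
    have hg : CauchySeq fun n => (f n : U.K) := by
      refine cauchySeq_of_le_geometric ‖(p : U.K)‖ 1 hp1 fun n => ?_
      rw [dist_eq_norm, one_mul]; exact hf n.le_succ
    obtain ⟨L, hL⟩ := cauchySeq_tendsto_of_complete hg
    have hL1 : ‖L‖ ≤ 1 := le_of_tendsto' hL.norm fun n => norm_coe_le_one (f n)
    refine ⟨⟨L, (mem_int_iff U).2 hL1⟩, fun n => ?_⟩
    exact le_of_tendsto ((tendsto_const_nhds.sub hL).norm) (eventually_atTop.2 ⟨n, fun k hk => hf hk⟩)

/-! ## 2. `p`-power-compatible sequences: heads, integrality, the multiplicative perfection `lim 𝒪_K` -/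

/-- Along a compatible sequence `x_n^{pⁿ} = x_0`. [folklore] -/
theorem pow_pow_eq_head {U : Untilt p} {x : ℕ → U.K} (hx : x ∈ powerCompatSeq U) (n : ℕ) : x n ^ p ^ n = x 0 := by
  induction n with
  | zero => simp
  | succ n ih => rw [pow_succ, pow_mul', hx n, ih]

/-- … hence `‖x_n‖^{pⁿ} = ‖x_0‖`. [folklore] -/
theorem norm_pow_pow_eq_head {U : Untilt p} {x : ℕ → U.K} (hx : x ∈ powerCompatSeq U) (n : ℕ) : ‖x n‖ ^ p ^ n = ‖x 0‖ := by
  rw [← norm_pow, pow_pow_eq_head hx]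

/-- A compatible sequence is integral in every degree iff it is in degree `0`. [folklore] -/
theorem norm_le_one_iff_head {U : Untilt p} {x : ℕ → U.K} (hx : x ∈ powerCompatSeq U) (n : ℕ) : ‖x n‖ ≤ 1 ↔ ‖x 0‖ ≤ 1 := by
  rw [← norm_pow_pow_eq_head hx n, pow_le_one_iff_of_nonneg (norm_nonneg _) (pow_ne_zero _ (Fact.out : p.Prime).ne_zero)]

/-- A compatible sequence vanishing in one degree vanishes in degree `0`. [folklore] -/
theorem head_eq_zero_of_apply_eq_zero {U : Untilt p} {x : ℕ → U.K} (hx : x ∈ powerCompatSeq U) {n : ℕ} (h : x n = 0) : x 0 = 0 := by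
  rw [← pow_pow_eq_head hx n, h, zero_pow (pow_ne_zero _ (Fact.out : p.Prime).ne_zero)]

/-- Compatible sequences are closed under coordinatewise inverse (`0⁻¹ = 0` included). [folklore] -/
theorem inv_mem {U : Untilt p} {x : ℕ → U.K} (hx : x ∈ powerCompatSeq U) : x⁻¹ ∈ powerCompatSeq U :=
  fun n => by rw [Pi.inv_apply, Pi.inv_apply, inv_pow, hx n]

/-- A chosen tower `(p, p^{1/p}, p^{1/p²}, …)` of `p`-power roots of `p` in `K` (alg. closed; `exists_powerCompatSeq_head`). [folklore] -/
def rootTower (U : Untilt p) : ℕ → U.K := Classical.choose (exists_powerCompatSeq_head U (p : U.K))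

/-- The tower is `p`-power compatible. [folklore] -/
theorem rootTower_mem (U : Untilt p) : rootTower U ∈ powerCompatSeq U :=
  (Classical.choose_spec (exists_powerCompatSeq_head U (p : U.K))).1

/-- The tower starts at `p`. [folklore] -/
theorem rootTower_zero (U : Untilt p) : rootTower U 0 = p :=
  (Classical.choose_spec (exists_powerCompatSeq_head U (p : U.K))).2

/-- An INTEGRAL compatible sequence as an element of Mathlib's multiplicative perfection `lim_{x ↦ x^p} 𝒪_K = Perfection 𝒪_K p`. [folklore] -/
def toPerfection (U : Untilt p) (x : ℕ → U.K) (hx : x ∈ powerCompatSeq U) (h0 : ‖x 0‖ ≤ 1) : Perfection (int U) p :=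
  ⟨fun n => ⟨x n, (mem_int_iff U).2 ((norm_le_one_iff_head hx n).2 h0)⟩,
    fun n => Subtype.ext (by rw [SubmonoidClass.coe_pow]; exact hx n)⟩

/-- Forgetting integrality: `lim 𝒪_K → (ℕ → K)`, a monoid map. [folklore] -/
def perfSeq (U : Untilt p) : Perfection (int U) p →* (ℕ → U.K) where
  toFun f n := ((Perfection.coeffMonoidHom (int U) p n f : int U) : U.K)
  map_one' := funext fun n => by simp
  map_mul' f g := funext fun n => by simp

/-- `perfSeq` lands in the compatible sequences. [folklore] -/
theorem perfSeq_mem (U : Untilt p) (f : Perfection (int U) p) : perfSeq U f ∈ powerCompatSeq U := fun n => by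
  show ((Perfection.coeffMonoidHom (int U) p (n + 1) f : int U) : U.K) ^ p = (Perfection.coeffMonoidHom (int U) p n f : int U)
  rw [← SubmonoidClass.coe_pow, Perfection.coeffMonoidHom_pow_p']

/-! ## 3. `𝒪_{K♭} = (𝒪_K/p)^perf → lim 𝒪_K` (Teichmüller) and `|·|_♭ = |(·)^♯|_K` on `𝒪_{K♭}` -/

section Integral

variable (U : Untilt p) [Fact (¬ IsUnit ((p : ℕ) : int U))]

/-- Mathlib's valuation `|·|_♭` on `𝒪_{K♭} = PreTilt 𝒪_K p` (for `K`, `‖·‖`, `𝒪_K`). [folklore] -/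
abbrev valInt : Valuation (PreTilt (int U) p) ℝ≥0 :=
  PreTilt.val U.K NormedField.valuation (int U) (Valuation.integer.integers _) p

variable [IsAdicComplete (Ideal.span {((p : ℕ) : int U)}) (int U)]

/-- **`x ↦ (x^{♯ 1/pⁿ})_n` on `𝒪_{K♭}`**: Mathlib's `(Perfection.quotientMulEquiv p (p)).symm : (𝒪_K/p)^perf ≃* lim 𝒪_K` (Teichmüller
limits in each degree, [Scholze 2012, Lem. 3.4 (i)]) followed by `perfSeq`. [folklore] -/
def flatInt : PreTilt (int U) p →* (ℕ → U.K) :=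
  (perfSeq U).comp (Perfection.quotientMulEquiv p (Ideal.span {((p : ℕ) : int U)})).symm.toMonoidHom

/-- `flatInt` lands in the compatible sequences. [folklore] -/
theorem flatInt_mem (f : PreTilt (int U) p) : flatInt U f ∈ powerCompatSeq U := perfSeq_mem U _

/-- Degree `0` of `flatInt` is the Teichmüller/untilt map `x ↦ x^♯`. [folklore] -/
theorem flatInt_apply_zero (f : PreTilt (int U) p) :
    flatInt U f 0 = ((Perfection.teichmuller₀ p (Ideal.span {((p : ℕ) : int U)}) f : int U) : U.K) :=
  congrArg (fun a : int U => (a : U.K)) (Perfection.coeff_zero_symm_quotientMulEquiv _)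

/-- **`|x|_♭ = |x^♯|_K` on `𝒪_{K♭}`**: Mathlib's `PreTilt.val` agrees with the norm of the Teichmüller representative (both are multiplicative
and agree on elements with nonzero degree-`0` coefficient, to which `x ↦ x^{1/pⁿ}` reduces). PROVED. [folklore] -/
theorem valInt_eq_nnnorm (f : PreTilt (int U) p) : valInt U f = ‖flatInt U f 0‖₊ := by
  classical
  by_cases hf : f = 0
  · subst hf
    have h0 : Perfection.teichmuller₀ p (Ideal.span {((p : ℕ) : int U)}) (0 : PreTilt (int U) p) = 0 := map_zero _
    rw [map_zero, flatInt_apply_zero, h0, ZeroMemClass.coe_zero, nnnorm_zero]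
  obtain ⟨n, hn⟩ : ∃ n, PreTilt.coeff n f ≠ 0 := not_forall.1 fun h => hf (Perfection.ext h)
  set I : Ideal (int U) := Ideal.span {((p : ℕ) : int U)} with hI
  set g := (frobeniusEquiv (PreTilt (int U) p) p).symm^[n] f with hg
  have hgf : g ^ p ^ n = f := iterate_frobeniusEquiv_symm_pow_p_pow (PreTilt (int U) p) p f n
  have hg0 : PreTilt.coeff 0 g ≠ 0 := by rw [hg, PreTilt.coeff_iterate_frobeniusEquiv_symm, zero_add]; exact hn
  have hmk : Ideal.Quotient.mk I (Perfection.teichmuller₀ p I g) = PreTilt.coeff 0 g := Perfection.mk_teichmuller₀ g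
  have key : valInt U g = ‖flatInt U g 0‖₊ := by
    rw [flatInt_apply_zero]
    calc valInt U g = ModP.preVal U.K NormedField.valuation (int U) p (PreTilt.coeff 0 g) ^ p ^ 0 :=
          PreTilt.valAux_eq (Valuation.integer.integers _) hg0
      _ = ModP.preVal U.K NormedField.valuation (int U) p (Ideal.Quotient.mk I (Perfection.teichmuller₀ p I g)) := by
          rw [pow_zero, pow_one, hmk]
      _ = NormedField.valuation (algebraMap (int U) U.K (Perfection.teichmuller₀ p I g)) :=
          ModP.preVal_mk (Valuation.integer.integers _) (by rw [hmk]; exact hg0)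
      _ = _ := rfl
  rw [← hgf, map_pow, map_pow, Pi.pow_apply, nnnorm_pow, key]

/-- `flatInt` of a nonzero element vanishes in no degree. [folklore] -/
theorem flatInt_apply_ne_zero {f : PreTilt (int U) p} (hf : f ≠ 0) (n : ℕ) : flatInt U f n ≠ 0 := fun h =>
  hf ((PreTilt.map_eq_zero _).1 (by rw [valInt_eq_nnnorm, head_eq_zero_of_apply_eq_zero (flatInt_mem U f) h, nnnorm_zero]))

/-- An integral compatible sequence as an element of `𝒪_{K♭}` (reduce each coordinate mod `p`). [folklore] -/
def ofSeq (x : ℕ → U.K) (hx : x ∈ powerCompatSeq U) (h0 : ‖x 0‖ ≤ 1) : PreTilt (int U) p :=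
  Perfection.quotientMulEquiv p (Ideal.span {((p : ℕ) : int U)}) (toPerfection U x hx h0)

/-- `flatInt ∘ ofSeq = id`: Teichmüller limits recover the sequence. [folklore] -/
theorem flatInt_ofSeq (x : ℕ → U.K) (hx : x ∈ powerCompatSeq U) (h0 : ‖x 0‖ ≤ 1) : flatInt U (ofSeq U x hx h0) = x := by
  show perfSeq U ((Perfection.quotientMulEquiv p (Ideal.span {((p : ℕ) : int U)})).symm
    (Perfection.quotientMulEquiv p (Ideal.span {((p : ℕ) : int U)}) (toPerfection U x hx h0))) = x
  rw [MulEquiv.symm_apply_apply]; rfl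

/-- `|ofSeq x|_♭ = ‖x_0‖`. [folklore] -/
theorem valInt_ofSeq (x : ℕ → U.K) (hx : x ∈ powerCompatSeq U) (h0 : ‖x 0‖ ≤ 1) : valInt U (ofSeq U x hx h0) = ‖x 0‖₊ := by
  rw [valInt_eq_nnnorm, flatInt_ofSeq]

/-- `ϖ♭ := (p, p^{1/p}, …) mod p`, a pseudo-uniformiser of `K♭` ([Scholze 2012, Lem. 3.4 (ii)] with `ϖ = p`). [folklore] -/
def varpi : PreTilt (int U) p := ofSeq U (rootTower U) (rootTower_mem U) (by rw [rootTower_zero]; exact U.norm_p_lt_one.le)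

/-- `(ϖ♭)^♯-tower = the root tower`. [folklore] -/
theorem flatInt_varpi : flatInt U (varpi U) = rootTower U := flatInt_ofSeq U _ _ _

/-- `|ϖ♭|_♭ = ‖p‖_K`. [folklore] -/
theorem valInt_varpi : valInt U (varpi U) = ‖(p : U.K)‖₊ := by rw [varpi, valInt_ofSeq, rootTower_zero]

/-- `ϖ♭ ≠ 0`. [folklore] -/
theorem varpi_ne_zero : varpi U ≠ 0 := fun h =>
  nnnorm_ne_zero_iff.2 (natCast_p_ne_zero U) (by rw [← valInt_varpi U, h, map_zero])

end Integral

/-! ## 4. The fraction field `K♭ = Frac 𝒪_{K♭}`: `|·|_♭`, the normed field, `flat`, surjectivity, isometry -/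

section Frac

variable (U : Untilt p) [Fact (¬ IsUnit ((p : ℕ) : int U))] [IsDomain (PreTilt (int U) p)]

/-- `K♭` presented as Mathlib's `FractionRing (PreTilt 𝒪_K p)` — DEFINITIONALLY `ATS1.tilt U` (`Tilt` unfolds to this); this spelling lets
type-class search find the fraction-field structure. [folklore] -/
abbrev tiltFr : Type := FractionRing (PreTilt (int U) p)

/-- Nonzero elements of `𝒪_{K♭}` have nonzero valuation: `(𝒪_{K♭})⁰ ≤ (supp |·|_♭)ᶜ`. [folklore] -/
theorem nonZeroDivisors_le_primeCompl : nonZeroDivisors (PreTilt (int U) p) ≤ (valInt U).supp.primeCompl := by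
  intro s hs
  rw [Ideal.mem_primeCompl_iff, Valuation.mem_supp_iff]
  exact fun h => nonZeroDivisors.ne_zero hs ((PreTilt.map_eq_zero _).1 h)

/-- **`|·|_♭` on `K♭`**: Mathlib's `PreTilt.val` extended to the fraction field (`|a/s|_♭ = |a|_♭/|s|_♭`). [folklore] -/
def valFr : Valuation (tiltFr U) ℝ≥0 :=
  (valInt U).extendToLocalization (nonZeroDivisors_le_primeCompl U) (tiltFr U)

/-- `|a|_♭` of an integral element. [folklore] -/
theorem valFr_algebraMap (a : PreTilt (int U) p) : valFr U (algebraMap _ (tiltFr U) a) = valInt U a :=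
  Valuation.extendToLocalization_apply_map_apply _ _ _ a

/-- `|a/s|_♭ = |a|_♭ · |s|_♭⁻¹`. [folklore] -/
theorem valFr_mk' (a : PreTilt (int U) p) (s : nonZeroDivisors (PreTilt (int U) p)) :
    valFr U (IsLocalization.mk' (tiltFr U) a s) = valInt U a * (valInt U s)⁻¹ :=
  Valuation.extendToLocalization_mk' _ _ _ a s

variable [IsAdicComplete (Ideal.span {((p : ℕ) : int U)}) (int U)]

/-- `ϖ♭` is a non-zero-divisor. [folklore] -/
theorem varpi_mem_nonZeroDivisors : varpi U ∈ nonZeroDivisors (PreTilt (int U) p) :=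
  mem_nonZeroDivisors_of_ne_zero (varpi_ne_zero U)

/-- **`|·|_♭` has rank one**: values in `ℝ≥0` (identity embedding of the value group) and `|ϖ♭|_♭ = ‖p‖ ∉ {0, 1}`. An explicit structure
term, NOT an instance. [folklore] -/
@[reducible] def rankOneValFr : (valFr U).RankOne where
  hom' := MonoidWithZeroHom.ValueGroup₀.embedding
  strictMono' := MonoidWithZeroHom.ValueGroup₀.embedding_strictMono
  exists_val_nontrivial := by
    have h : (‖(p : U.K)‖₊ : ℝ) < 1 := by rw [coe_nnnorm]; exact U.norm_p_lt_one
    refine ⟨algebraMap _ (tiltFr U) (varpi U), ?_, ?_⟩ <;> rw [valFr_algebraMap, valInt_varpi]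
    exacts [nnnorm_ne_zero_iff.2 (natCast_p_ne_zero U), ne_of_lt (by exact_mod_cast h)]

/-- **The normed field `(K♭, |·|_♭)`** — the `NormedField` structure on `K♭` determined by the rank-one valuation `|·|_♭` (Mathlib's
`Valued.toNormedField`). An explicit `def`, NOT an instance (typer lint). [folklore] -/
@[reducible] def normedFieldFr : NormedField (tiltFr U) :=
  letI : Valued (tiltFr U) ℝ≥0 := Valued.mk' (valFr U)
  letI : (Valued.v (R := tiltFr U) (Γ₀ := ℝ≥0)).RankOne := rankOneValFr U
  Valued.toNormedField (tiltFr U) ℝ≥0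

/-- The norm of `normedFieldFr` IS `|·|_♭`. [folklore] -/
theorem norm_eq_valFr (x : tiltFr U) : (letI := normedFieldFr U; ‖x‖) = (valFr U x : ℝ) := by
  change ((MonoidWithZeroHom.ValueGroup₀.embedding ((valFr U).restrict x) : ℝ≥0) : ℝ) = _
  rw [Valuation.embedding_restrict]

/-- `flatInt s` is a unit of `ℕ → K` (no coordinate vanishes) for `s ∈ (𝒪_{K♭})⁰`. [folklore] -/
theorem isUnit_flatInt (s : nonZeroDivisors (PreTilt (int U) p)) : IsUnit (flatInt U s) :=
  Pi.isUnit_iff.2 fun n => isUnit_iff_ne_zero.2 (flatInt_apply_ne_zero U (nonZeroDivisors.coe_ne_zero s) n)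

/-- **`x ↦ (x^{♯ 1/pⁿ})_n` on all of `K♭`**: the monoid-localization lift of `flatInt` along `𝒪_{K♭} → K♭` (`a/s ↦ flatInt a · (flatInt s)⁻¹`).
[folklore] -/
def flatFr : tiltFr U →* (ℕ → U.K) :=
  (IsLocalization.toLocalizationMap (nonZeroDivisors (PreTilt (int U) p)) (tiltFr U)).lift (isUnit_flatInt U)

/-- `flatFr (a/s) = flatInt a · (flatInt s)⁻¹`. [folklore] -/
theorem flatFr_mk' (a : PreTilt (int U) p) (s : nonZeroDivisors (PreTilt (int U) p)) :
    flatFr U (IsLocalization.mk' (tiltFr U) a s) = flatInt U a * (flatInt U s)⁻¹ :=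
  ((IsLocalization.toLocalizationMap (nonZeroDivisors (PreTilt (int U) p)) (tiltFr U)).lift_mk'_spec
    (isUnit_flatInt U) a _ s).2 (funext fun n => by
      simp only [Pi.mul_apply, Pi.inv_apply]
      rw [mul_comm (flatInt U a n) _, mul_inv_cancel_left₀ (flatInt_apply_ne_zero U (nonZeroDivisors.coe_ne_zero s) n)])

/-- `flatFr` lands in the compatible sequences. [folklore] -/
theorem flatFr_mem (z : tiltFr U) : flatFr U z ∈ powerCompatSeq U := by
  obtain ⟨⟨a, s⟩, rfl⟩ := IsLocalization.mk'_surjective (nonZeroDivisors (PreTilt (int U) p)) z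
  show flatFr U (IsLocalization.mk' (tiltFr U) a s) ∈ powerCompatSeq U
  rw [flatFr_mk']
  exact (powerCompatSeq U).mul_mem (flatInt_mem U a) (inv_mem (flatInt_mem U s))

/-- **`flatFr` is ONTO `lim_{x ↦ x^p} K`** ([Scholze 2012, Lem. 3.4 (iii)] «`K♭ = lim K`» multiplicatively): scale a compatible sequence
into `lim 𝒪_K` by a power of the root tower, reduce mod `p`, divide by the same power of `ϖ♭`. PROVED. [folklore] -/
theorem flatFr_surj (x : ℕ → U.K) (hx : x ∈ powerCompatSeq U) : ∃ z : tiltFr U, flatFr U z = x := by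
  obtain ⟨k, hk⟩ : ∃ k : ℕ, ‖x 0‖ * ‖(p : U.K)‖ ^ k ≤ 1 := by
    rcases le_or_gt ‖x 0‖ 1 with h | h
    · exact ⟨0, by simpa using h⟩
    · have h0 : 0 < ‖x 0‖ := one_pos.trans h
      obtain ⟨k, hk⟩ := exists_pow_lt_of_lt_one (inv_pos.2 h0) U.norm_p_lt_one
      have := mul_lt_mul_of_pos_left hk h0
      exact ⟨k, le_of_lt (by rwa [mul_inv_cancel₀ h0.ne'] at this)⟩
  have hy : x * rootTower U ^ k ∈ powerCompatSeq U := (powerCompatSeq U).mul_mem hx ((powerCompatSeq U).pow_mem (rootTower_mem U) k)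
  have hy0 : ‖(x * rootTower U ^ k) 0‖ ≤ 1 := by rw [Pi.mul_apply, Pi.pow_apply, rootTower_zero, norm_mul, norm_pow]; exact hk
  refine ⟨IsLocalization.mk' (tiltFr U) (ofSeq U _ hy hy0) ⟨varpi U ^ k, pow_mem (varpi_mem_nonZeroDivisors U) k⟩, ?_⟩
  refine ((IsLocalization.toLocalizationMap (nonZeroDivisors (PreTilt (int U) p)) (tiltFr U)).lift_mk'_spec
    (isUnit_flatInt U) _ _ _).2 ?_
  show flatInt U (ofSeq U _ hy hy0) = flatInt U (varpi U ^ k) * x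
  rw [flatInt_ofSeq, map_pow, flatInt_varpi, mul_comm]

/-- **`‖(flatFr z)_0‖_K = |z|_♭`**: the degree-`0` isometry ([Scholze 2012, Lem. 3.4 (iii)] «|x|_{K♭} = |x^♯|_K»). PROVED. [folklore] -/
theorem nnnorm_flatFr_zero (z : tiltFr U) : ‖flatFr U z 0‖₊ = valFr U z := by
  obtain ⟨⟨a, s⟩, rfl⟩ := IsLocalization.mk'_surjective (nonZeroDivisors (PreTilt (int U) p)) z
  show ‖flatFr U (IsLocalization.mk' (tiltFr U) a s) 0‖₊ = valFr U (IsLocalization.mk' (tiltFr U) a s)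
  rw [flatFr_mk', valFr_mk', Pi.mul_apply, Pi.inv_apply, nnnorm_mul, nnnorm_inv, valInt_eq_nnnorm U a, valInt_eq_nnnorm U (s : PreTilt (int U) p)]

/-- **THE MODEL (fraction-field presentation)**: the tilt monoid datum of `K` on `(K♭, |·|_♭)`. CONSTRUCTED. [folklore] -/
def datumFr : @TiltMonoidDatum p _ U (tiltFr U) (normedFieldFr U) :=
  @TiltMonoidDatum.mk p _ U (tiltFr U) (normedFieldFr U) (flatFr U) (flatFr_mem U) (fun y y' => map_mul (flatFr U) y y')
    (flatFr_surj U) (fun y => by rw [norm_eq_valFr, ← nnnorm_flatFr_zero, coe_nnnorm])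

end Frac

/-! ## 5. On `ATS1.tilt U` itself, hypothesis-free; transport along isometries; Prop. 4.1.7 (1) for `K` and `K♭` -/

/-- `𝒪_{K♭}` is a domain (Mathlib, from the valuation). [folklore] -/
theorem isDomain_preTilt (U : Untilt p) :
    haveI : Fact (¬ IsUnit ((p : ℕ) : int U)) := ⟨not_isUnit_p U⟩
    IsDomain (PreTilt (int U) p) :=
  haveI : Fact (¬ IsUnit ((p : ℕ) : int U)) := ⟨not_isUnit_p U⟩
  PreTilt.isDomain U.K NormedField.valuation (int U) (Valuation.integer.integers _) p

/-- **The normed field `(K♭, |·|_♭)` on `ATS1.tilt U`** (= Mathlib's `Tilt K ‖·‖ 𝒪_K p`), no hypotheses: an explicit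
`NormedField (tilt U)` term (NOT an instance) whose norm is `|x|_♭ = |x^♯|_K`. [folklore] -/
@[reducible] def normedFieldTilt (U : Untilt p) : NormedField (tilt U) :=
  haveI : Fact (¬ IsUnit ((p : ℕ) : int U)) := ⟨not_isUnit_p U⟩
  haveI : IsDomain (PreTilt (int U) p) := isDomain_preTilt U
  haveI : IsAdicComplete (Ideal.span {((p : ℕ) : int U)}) (int U) := isAdicComplete_int U
  normedFieldFr U

/-- **THE MODEL: `TiltMonoidDatum U (tilt U)`** — Joshi's tilting datum «K♭ ≃ F isometrically» ([J-I] §3.5 p.9 l.38–40, Def. 4.1.1 (1)) at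
`F := K♭` ITSELF, read multiplicatively: CONSTRUCTED for every untilt, no hypotheses (the instance slot is the explicit `normedFieldTilt U`).
Hence the signature `TiltMonoidDatum` of p433682/p437482 is inhabited (non-vacuity). [folklore] -/
def tiltMonoidDatum (U : Untilt p) : @TiltMonoidDatum p _ U (tilt U) (normedFieldTilt U) :=
  haveI : Fact (¬ IsUnit ((p : ℕ) : int U)) := ⟨not_isUnit_p U⟩
  haveI : IsDomain (PreTilt (int U) p) := isDomain_preTilt U
  haveI : IsAdicComplete (Ideal.span {((p : ℕ) : int U)}) (int U) := isAdicComplete_int U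
  datumFr U

/-- **Transport along a multiplicative isometry** — Joshi's hypothesis «F isometric to K♭» (Def. 4.1.1 (1)) PRODUCES the datum over `F`:
compose `flat` with the inverse isometry. [folklore] -/
def _root_.Summit.ABC.IUTFork.Joshi.ATS1.TiltMonoidDatum.transport {U : Untilt p} {F F' : Type} [NormedField F] [NormedField F']
    (T : TiltMonoidDatum U F) (ι : F ≃* F') (hι : ∀ y, ‖ι y‖ = ‖y‖) : TiltMonoidDatum U F' where
  flat y := T.flat (ι.symm y)
  flat_mem y := T.flat_mem _
  flat_mul y y' := by rw [map_mul, T.flat_mul]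
  flat_surj x hx := by
    obtain ⟨y, hy⟩ := T.flat_surj x hx
    exact ⟨ι y, by rw [MulEquiv.symm_apply_apply, hy]⟩
  norm_flat y := by rw [T.norm_flat, ← hι, MulEquiv.apply_symm_apply]

/-- **The datum over any `F` multiplicatively isometric to `K♭`** (Def. 4.1.1 (1) verbatim ⟹ `TiltMonoidDatum U F`). [folklore] -/
def tiltMonoidDatumOfIsometry (U : Untilt p) {F : Type} [NormedField F]
    (ι : letI := normedFieldTilt U; tilt U ≃* F) (hι : ∀ y, ‖ι y‖ = (letI := normedFieldTilt U; ‖y‖)) : TiltMonoidDatum U F :=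
  letI := normedFieldTilt U
  (tiltMonoidDatum U).transport ι hι

/-- **[J-I] Prop. 4.1.7 (1) «the same value groups» for `K` and its OWN tilt `(K♭, |·|_♭)` — UNCONDITIONAL** (p433682's
`TiltMonoidDatum.range_norm_eq` at the constructed datum; = [Scholze 2012, Lem. 3.4 (iii)] «|K♭ˣ| = |Kˣ|»). PROVED. [folklore] -/
theorem range_norm_tilt_eq (U : Untilt p) :
    Set.range (fun y : tilt U => letI := normedFieldTilt U; ‖y‖) = Set.range (fun a : U.K => ‖a‖) :=
  (@TiltMonoidDatum.range_norm_eq p _ U (tilt U) (normedFieldTilt U) (tiltMonoidDatum U)).symm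

end TiltModel

end Summit.ABC.IUTFork.Joshi.ATS1

end
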